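import Summits.Ventures.Crystal3D.Theorems.StickyWulffConstantGenericWallFloorHRowStart
import Summits.Ventures.Crystal3D.Theorems.StickyWulffConstantGenericWallFloorHRowRun
import Summits.Ventures.Crystal3D.Theorems.StickyWulffConstantGenericWallFloorHRowEndFarDefs
import Summits.Ventures.Crystal3D.Theorems.StickyWulffConstantGenericWallFloorHStarTransport
import Summits.Ventures.Crystal3D.Theorems.StickyWulffConstantGenericWallFloorBarlowRowLineFamily
import Summits.Ventures.Crystal3D.Theorems.StickyWulffConstantNoReconstructionGainSymmetry
import HarnessLib

/-!
# The h-LAYER ROW MEMBERS of the LAYER ROWS family: one launched h-row walker delivers an END in `PAY`, on its own row line,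
# carrying no rising certified stack-walker state (crux `GenericWallFloor`, stmt-Ventures-19480, kernel G; cf-p1 RULINGS (ccxi)/(ccxiii),
# step (ii) of the R1 order; sequel of `…HRowStart` p716238, `…HRowRun` p716523, `…HRowEndFarDefs` p717949, `…HStarTransport` p716097)

HONEST FRAMING. Venture `Summits/Ventures/Crystal3D` (cell `crystal3d-full`), route `route-Ventures-StickyWulffConstant`, helper for the crux
`GenericWallFloor` (stmt-Ventures-19480) / consumer `TextureLiminfV5` (stmt-Ventures-23912).  Bookkeeping on landed pieces; inputs BY NAME:
`HStarModel` (E1h, pattern A12-583, to be certified) and `HRowEndFar` ((J-b), RULING (ccxiii)(A)); F-C1 not moved; NOT R1.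

THE POINT.  In the wall cell (plates `P₁ = stacking L₁ s₀ σ₁ ∩ [−2R₀, −R₀]`, `P₂ = stacking L₂ s₂ σ₂ ∩ [h+R₀, h+2R₀]`, lateral `≤ ρ`), an
h-row walker is launched one row step beyond a deep h-layer site: START `y₀ = L₁ (barlowPos σ₁ k a b) + s₀` whose row predecessor
`barlowPos σ₁ k (a − α) (b − β)` (`u = α·t₁ + β·t₂` the in-plane row slot, `(L₁ u)₂ ≥ 3/4`) is deep inside plate 1, hence h-FULL.  Type A layers
(`σ₁ (k−1) = −1, σ₁ k = 1`) walk with frame `L₁` along `u`; type B layers (`σ₁ (k−1) = 1, σ₁ k = −1`) with the point-reflected frame `neg ≫ L₁`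
along `−u` — the same physical direction `L₁ u`.  Per member (`hRow_member_A`, `hRow_member_B`): the run ENDS at `y₀ + n·L₁u` (`n ≤ N`), the end
lies in `PAY = {deg ≠ 12, −R₀−2 ≤ y₂ ≤ h+R₀+2}` (`hRow_end_of_model`; NOT HIGH `hRow_end_not_high` under the apartness `L₁·Λ₀ ≠ L₂·Λ₀, twin`; NOT
LOW `hRow_end_not_low`), and — under `HRowEndFar` — it carries NO strongly certified stack-walker state `⟨F′, q, 0⟩` rising by `≥ 3/8` (so the
h-ends are disjoint from the c-rows' end balls, whose top entries rise by `≥ 3/8`).  `layerRow_end_eq` : ends on distinct row lines are distinct.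
* `image_negTrans_fcc` — `(neg ≫ L)·Λ₀ = L·Λ₀`; `sqrt_two_div_two_le`; **`hRow_member_A`**, **`hRow_member_B`**; **`layerRow_end_eq`**.
WHAT THIS IS NOT: not the c-rows, not the count, not R1; F-C1 not moved.
-/

noncomputable section

namespace Summit.Ventures.Crystal3D.Theorems

open Finset
open Literature.MathematicalPhysics.StatisticalMechanics
open Summit.Ventures.Crystal3D.Cruxes.TextureLiminf.TexShadow (stacking bestLayerDir)
open scoped InnerProductSpace

variable {X : Finset (EuclideanSpace ℝ (Fin 3))}

/-! ### Small facts -/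

/-- The point-reflected frame carries the same lattice: `(neg ≫ L)·Λ₀ = L·Λ₀`. -/
theorem image_negTrans_fcc (L : EuclideanSpace ℝ (Fin 3) ≃ₗᵢ[ℝ] EuclideanSpace ℝ (Fin 3)) :
    ((LinearIsometryEquiv.neg ℝ).trans L) '' fccStacking 1 (Real.sqrt (2 / 3)) = L '' fccStacking 1 (Real.sqrt (2 / 3)) := by
  ext y
  constructor
  · rintro ⟨x, hx, rfl⟩
    exact ⟨-x, fcc_neg_mem hx, rfl⟩
  · rintro ⟨x, hx, rfl⟩
    exact ⟨-x, fcc_neg_mem hx, by simp⟩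

/-- `√2/2 ≤ 3/4`. -/
theorem sqrt_two_div_two_le : Real.sqrt 2 / 2 ≤ (3 : ℝ) / 4 := by
  have h : Real.sqrt 2 ≤ 3 / 2 := by
    rw [Real.sqrt_le_left (by norm_num)]; norm_num
  linarith

/-! ### One h-row member -/

section Cell

variable (σ₁ : ℤ → ℤ) (L₁ : EuclideanSpace ℝ (Fin 3) ≃ₗᵢ[ℝ] EuclideanSpace ℝ (Fin 3)) (s₀ : EuclideanSpace ℝ (Fin 3))

/-- The common core of the two member lemmas: an h-row run in the frame `F` along `v` (`F v = L₁ u`, rise `≥ 3/4`), started at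
`y₀ = L₁ (barlowPos σ₁ k a b) + s₀` with `HRowInv`, `y₀` in the launch band and laterally inside: the END is `y₀ + n·F v`, lies in `PAY`, the walk
has stopped there with `HRowInv`, and under `HRowEndFar` no rising strongly certified state sits there. -/
theorem hRow_member_core (hX : ∀ p ∈ X, ∀ q ∈ X, p ≠ q → 1 ≤ dist p q) (hσ₁ : IsHaggSeq σ₁)
    (hModel : HStarModel) (hJ : HRowEndFar)
    {σ₂ : ℤ → ℤ} (hσ₂ : IsHaggSeq σ₂) (L₂ : EuclideanSpace ℝ (Fin 3) ≃ₗᵢ[ℝ] EuclideanSpace ℝ (Fin 3)) (s₂ : EuclideanSpace ℝ (Fin 3))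
    (R₀ h ρ : ℝ) (hR₀ : 4 ≤ R₀) (hh : 0 ≤ h) (P₁ P₂ : Finset (EuclideanSpace ℝ (Fin 3))) (hP₁X : P₁ ⊆ X) (hP₂X : P₂ ⊆ X)
    (hcell : ∀ p ∈ X, -(2 * R₀) ≤ p 2 ∧ p 2 ≤ h + 2 * R₀ ∧ p 0 ^ 2 + p 1 ^ 2 ≤ ρ ^ 2)
    (hP₁ : ∀ p, p ∈ P₁ ↔ (p ∈ stacking L₁ s₀ σ₁ ∧ -(2 * R₀) ≤ p 2 ∧ p 2 ≤ -R₀ ∧ p 0 ^ 2 + p 1 ^ 2 ≤ ρ ^ 2))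
    (hP₂ : ∀ p, p ∈ P₂ ↔ (p ∈ stacking L₂ s₂ σ₂ ∧ h + R₀ ≤ p 2 ∧ p 2 ≤ h + 2 * R₀ ∧ p 0 ^ 2 + p 1 ^ 2 ≤ ρ ^ 2))
    {F : EuclideanSpace ℝ (Fin 3) ≃ₗᵢ[ℝ] EuclideanSpace ℝ (Fin 3)} {v : EuclideanSpace ℝ (Fin 3)} (hv : v ∈ fccSlots) (hv2 : v 2 = 0)
    (hrise : (3 / 4 : ℝ) ≤ (F v) 2)
    (hapart : F '' fccStacking 1 (Real.sqrt (2 / 3)) ≠ L₂ '' fccStacking 1 (Real.sqrt (2 / 3)) ∧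
      F '' fccStacking 1 (Real.sqrt (2 / 3)) ≠
        (twinFrame L₂ (L₂ (EuclideanSpace.single (2 : Fin 3) (1 : ℝ)))) '' fccStacking 1 (Real.sqrt (2 / 3)))
    {y₀ : EuclideanSpace ℝ (Fin 3)} (hI : HRowInv X F v y₀)
    (hylo : -(2 * R₀) + 2 ≤ y₀ 2) (hyhi : y₀ 2 ≤ -R₀ - 2)
    (hylat : Real.sqrt (y₀ 0 ^ 2 + y₀ 1 ^ 2) + 4 / 3 * (h + 4 * R₀) + 4 ≤ ρ)
    {N : ℕ} (hN : h + 4 * R₀ ≤ 3 / 4 * (N : ℝ)) :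
    ∃ n : ℕ, n ≤ N ∧ hRowRun X F v N y₀ = y₀ + (n : ℝ) • F v ∧
      HRowInv X F v (hRowRun X F v N y₀) ∧ hRowStep X F v (hRowRun X F v N y₀) = none ∧
      hRowRun X F v N y₀ ∈ X.filter (fun y => (X.filter fun q => dist y q = 1).card ≠ 12 ∧ -R₀ - 2 ≤ y 2 ∧ y 2 ≤ h + R₀ + 2) ∧
      ∀ (F' : EuclideanSpace ℝ (Fin 3) ≃ₗᵢ[ℝ] EuclideanSpace ℝ (Fin 3)) (q : EuclideanSpace ℝ (Fin 3)), q ∈ fccSlots →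
        (3 : ℝ) / 8 ≤ (F' q) 2 → ¬ WalkCertified12 X (hRowRun X F v N y₀) ⟨F', q, 0⟩ := by
  classical
  set e₃ : EuclideanSpace ℝ (Fin 3) := EuclideanSpace.single (2 : Fin 3) (1 : ℝ) with he₃
  have he₃n : ‖e₃‖ = 1 := by rw [he₃, PiLp.norm_single, norm_one]
  have he₃i : ∀ d : EuclideanSpace ℝ (Fin 3), ⟪d, e₃⟫_ℝ = d 2 := fun d => by
    rw [he₃, EuclideanSpace.inner_single_right]; simp
  -- fuel in the three forms
  have hN' : h + 2 * R₀ - y₀ 2 < 3 / 4 * N := by linarith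
  have hH : ∀ p ∈ X, ⟪p, e₃⟫_ℝ ≤ h + 2 * R₀ := fun p hp => by rw [he₃i]; exact (hcell p hp).2.1
  have hrise' : (3 / 4 : ℝ) ≤ ⟪F v, e₃⟫_ℝ := by rw [he₃i]; exact hrise
  have hNm : h + 2 * R₀ - ⟪y₀, e₃⟫_ℝ < 3 / 4 * (N : ℝ) := by rw [he₃i]; exact hN'
  -- the end
  obtain ⟨n, hn, hrun, hendX, hstop, hdeg⟩ := hRow_end_of_model hX hModel hv hv2 hrise' hH hI hNm
  obtain ⟨n', -, hrun', hInv, -⟩ := hRowRun_spec (X := X) (F := F) hv hv2 N hI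
  have hhigh := hRow_end_not_high hX hσ₂ L₂ s₂ R₀ h ρ hR₀ hh P₂ hP₂X hcell hP₂ hv hv2 hapart hrise
    (hStarCertifiedAt_of_model hModel F hv hv2) hI (by linarith) hylat hN'
  have hlow := hRow_end_not_low hX hσ₁ L₁ s₀ R₀ h ρ hR₀ hh P₁ hP₁X hcell hP₁ hv hv2 hrise
    (hStarCertifiedAt_of_model hModel F hv hv2) hI (by linarith) hylat hN'
  refine ⟨n, hn, hrun, hInv, hstop, ?_, fun F' q hq hq' => ?_⟩
  · rw [Finset.mem_filter]
    exact ⟨hendX, by omega, by linarith, by linarith⟩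
  · have hsteep : Real.sqrt 2 / 2 ≤ ⟪F v, e₃⟫_ℝ := le_trans sqrt_two_div_two_le hrise'
    have hq'' : (3 : ℝ) / 8 ≤ ⟪F' q, e₃⟫_ℝ := by rw [he₃i]; exact hq'
    exact HRowEndFar.not_certified12 hJ hX hv hv2 hq he₃n hsteep hq'' hInv hstop

/-- **h-ROW MEMBER, type A** (`σ₁ (k−1) = −1`, `σ₁ k = 1`; frame `L₁`, direction `u`).  The start `y₀ = L₁ (barlowPos σ₁ k a b) + s₀` in the launch
band `[−2R₀+2, −R₀−2]`, laterally inside by `(4/3)(h+4R₀) + 5`; its row predecessor `barlowPos σ₁ k (a−α) (b−β)` is then deep inside plate 1.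
Conclusion: the END `hRowRun X L₁ u N y₀ = y₀ + n·L₁u` lies in `PAY` and carries no strongly certified state rising by `≥ 3/8`. -/
theorem hRow_member_A (hX : ∀ p ∈ X, ∀ q ∈ X, p ≠ q → 1 ≤ dist p q) (hσ₁ : IsHaggSeq σ₁)
    (hModel : HStarModel) (hJ : HRowEndFar)
    {σ₂ : ℤ → ℤ} (hσ₂ : IsHaggSeq σ₂) (L₂ : EuclideanSpace ℝ (Fin 3) ≃ₗᵢ[ℝ] EuclideanSpace ℝ (Fin 3)) (s₂ : EuclideanSpace ℝ (Fin 3))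
    (R₀ h ρ : ℝ) (hR₀ : 4 ≤ R₀) (hh : 0 ≤ h) (hρ : 1 ≤ ρ) (P₁ P₂ : Finset (EuclideanSpace ℝ (Fin 3))) (hP₁X : P₁ ⊆ X) (hP₂X : P₂ ⊆ X)
    (hcell : ∀ p ∈ X, -(2 * R₀) ≤ p 2 ∧ p 2 ≤ h + 2 * R₀ ∧ p 0 ^ 2 + p 1 ^ 2 ≤ ρ ^ 2)
    (hP₁ : ∀ p, p ∈ P₁ ↔ (p ∈ stacking L₁ s₀ σ₁ ∧ -(2 * R₀) ≤ p 2 ∧ p 2 ≤ -R₀ ∧ p 0 ^ 2 + p 1 ^ 2 ≤ ρ ^ 2))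
    (hP₂ : ∀ p, p ∈ P₂ ↔ (p ∈ stacking L₂ s₂ σ₂ ∧ h + R₀ ≤ p 2 ∧ p 2 ≤ h + 2 * R₀ ∧ p 0 ^ 2 + p 1 ^ 2 ≤ ρ ^ 2))
    {u : EuclideanSpace ℝ (Fin 3)} (hu : u ∈ fccSlots) (α β : ℤ) (huαβ : u = (α : ℝ) • triangularVec₁ 1 + (β : ℝ) • triangularVec₂ 1)
    (hrise : (3 / 4 : ℝ) ≤ (L₁ u) 2)
    (hapart : L₁ '' fccStacking 1 (Real.sqrt (2 / 3)) ≠ L₂ '' fccStacking 1 (Real.sqrt (2 / 3)) ∧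
      L₁ '' fccStacking 1 (Real.sqrt (2 / 3)) ≠
        (twinFrame L₂ (L₂ (EuclideanSpace.single (2 : Fin 3) (1 : ℝ)))) '' fccStacking 1 (Real.sqrt (2 / 3)))
    (k a b : ℤ) (hk' : σ₁ (k - 1) = -1) (hk : σ₁ k = 1)
    (hylo : -(2 * R₀) + 2 ≤ (L₁ (barlowPos 1 (Real.sqrt (2 / 3)) σ₁ k a b) + s₀) 2)
    (hyhi : (L₁ (barlowPos 1 (Real.sqrt (2 / 3)) σ₁ k a b) + s₀) 2 ≤ -R₀ - 2)
    (hylat : Real.sqrt ((L₁ (barlowPos 1 (Real.sqrt (2 / 3)) σ₁ k a b) + s₀) 0 ^ 2 +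
      (L₁ (barlowPos 1 (Real.sqrt (2 / 3)) σ₁ k a b) + s₀) 1 ^ 2) + 4 / 3 * (h + 4 * R₀) + 5 ≤ ρ)
    {N : ℕ} (hN : h + 4 * R₀ ≤ 3 / 4 * (N : ℝ)) :
    ∃ n : ℕ, n ≤ N ∧
      hRowRun X L₁ u N (L₁ (barlowPos 1 (Real.sqrt (2 / 3)) σ₁ k a b) + s₀) =
        L₁ (barlowPos 1 (Real.sqrt (2 / 3)) σ₁ k a b) + s₀ + (n : ℝ) • L₁ u ∧
      hRowRun X L₁ u N (L₁ (barlowPos 1 (Real.sqrt (2 / 3)) σ₁ k a b) + s₀) ∈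
        X.filter (fun y => (X.filter fun q => dist y q = 1).card ≠ 12 ∧ -R₀ - 2 ≤ y 2 ∧ y 2 ≤ h + R₀ + 2) ∧
      ∀ (F' : EuclideanSpace ℝ (Fin 3) ≃ₗᵢ[ℝ] EuclideanSpace ℝ (Fin 3)) (q : EuclideanSpace ℝ (Fin 3)), q ∈ fccSlots →
        (3 : ℝ) / 8 ≤ (F' q) 2 →
          ¬ WalkCertified12 X (hRowRun X L₁ u N (L₁ (barlowPos 1 (Real.sqrt (2 / 3)) σ₁ k a b) + s₀)) ⟨F', q, 0⟩ := by
  classical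
  have hu2 : u 2 = 0 := by
    rw [huαβ]
    obtain ⟨-, -, h12, -, -, h22⟩ := Summit.Ventures.Crystal3D.Cruxes.TextureLiminf.TexShadow.triangularVec_coords
    simp [h12, h22]
  have hLu1 : ‖L₁ u‖ = 1 := by rw [LinearIsometryEquiv.norm_map, norm_eq_one_of_mem_fccSlots hu]
  have hLu2 : (L₁ u) 2 ≤ 1 := by
    have h1 := abs_apply_sub_le_dist (L₁ u) 0 2
    rw [dist_zero_right, hLu1] at h1
    have : (0 : EuclideanSpace ℝ (Fin 3)) 2 = 0 := rfl
    rw [this, sub_zero] at h1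
    exact (abs_le.1 h1).2
  -- the predecessor site and the start
  set p₀ := barlowPos 1 (Real.sqrt (2 / 3)) σ₁ k (a - α) (b - β) with hp₀
  have hp₀u : p₀ + u = barlowPos 1 (Real.sqrt (2 / 3)) σ₁ k a b := by
    rw [hp₀, huαβ, barlowPos_add_inplane, sub_add_cancel, sub_add_cancel]
  have hy₀ : L₁ (barlowPos 1 (Real.sqrt (2 / 3)) σ₁ k a b) + s₀ = L₁ p₀ + s₀ + L₁ u := by
    rw [← hp₀u, map_add]; abel
  -- the predecessor is deep inside plate 1: heights and lateral radius
  have hp2 : (L₁ p₀ + s₀) 2 = (L₁ (barlowPos 1 (Real.sqrt (2 / 3)) σ₁ k a b) + s₀) 2 - (L₁ u) 2 := by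
    rw [hy₀]; simp
  have hplat : Real.sqrt ((L₁ p₀ + s₀) 0 ^ 2 + (L₁ p₀ + s₀) 1 ^ 2) ≤
      Real.sqrt ((L₁ (barlowPos 1 (Real.sqrt (2 / 3)) σ₁ k a b) + s₀) 0 ^ 2 +
        (L₁ (barlowPos 1 (Real.sqrt (2 / 3)) σ₁ k a b) + s₀) 1 ^ 2) + 1 := by
    have h1 := sqrt_lateral_add_le (L₁ (barlowPos 1 (Real.sqrt (2 / 3)) σ₁ k a b) + s₀) (-(L₁ u))
    have e : L₁ (barlowPos 1 (Real.sqrt (2 / 3)) σ₁ k a b) + s₀ + -L₁ u = L₁ p₀ + s₀ := by rw [hy₀]; abel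
    rw [e, norm_neg, hLu1] at h1
    exact h1
  have hcomp : ∀ q ∈ barlowStacking 1 (Real.sqrt (2 / 3)) σ₁, dist q p₀ ≤ 1 → L₁ q + s₀ ∈ X := by
    refine barlowWindow_complete L₁ s₀ R₀ ρ hρ P₁ hP₁X hP₁ k (a - α) (b - β) (by rw [hp2]; linarith) (by rw [hp2]; linarith) ?_
    have h0 : 0 ≤ (L₁ p₀ + s₀) 0 ^ 2 + (L₁ p₀ + s₀) 1 ^ 2 := by positivity
    have hrr : Real.sqrt ((L₁ p₀ + s₀) 0 ^ 2 + (L₁ p₀ + s₀) 1 ^ 2) ≤ ρ - 1 := by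
      have : 0 ≤ 4 / 3 * (h + 4 * R₀) := by positivity
      linarith
    have hρ1 : 0 ≤ ρ - 1 := by linarith
    have h7 := pow_le_pow_left₀ (Real.sqrt_nonneg _) hrr 2
    rwa [Real.sq_sqrt h0] at h7
  -- the invariant at the start
  have hI : HRowInv X L₁ u (L₁ (barlowPos 1 (Real.sqrt (2 / 3)) σ₁ k a b) + s₀) := by
    rw [hy₀]; exact hRowInv_start_barlow_A σ₁ L₁ s₀ k (a - α) (b - β) hk' hk hcomp hu hu2
  obtain ⟨n, hn, hrun, -, -, hPAY, hfar⟩ := hRow_member_core σ₁ L₁ s₀ hX hσ₁ hModel hJ hσ₂ L₂ s₂ R₀ h ρ hR₀ hh P₁ P₂ hP₁X hP₂X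
    hcell hP₁ hP₂ hu hu2 hrise hapart hI hylo hyhi (by linarith) hN
  exact ⟨n, hn, hrun, hPAY, hfar⟩

/-- **h-ROW MEMBER, type B** (`σ₁ (k−1) = 1`, `σ₁ k = −1`; frame `neg ≫ L₁`, direction `−u`, physical direction `L₁ u`).  Same hypotheses and
conclusion as type A, the END being `hRowRun X (neg ≫ L₁) (−u) N y₀ = y₀ + n·L₁u`. -/
theorem hRow_member_B (hX : ∀ p ∈ X, ∀ q ∈ X, p ≠ q → 1 ≤ dist p q) (hσ₁ : IsHaggSeq σ₁)
    (hModel : HStarModel) (hJ : HRowEndFar)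
    {σ₂ : ℤ → ℤ} (hσ₂ : IsHaggSeq σ₂) (L₂ : EuclideanSpace ℝ (Fin 3) ≃ₗᵢ[ℝ] EuclideanSpace ℝ (Fin 3)) (s₂ : EuclideanSpace ℝ (Fin 3))
    (R₀ h ρ : ℝ) (hR₀ : 4 ≤ R₀) (hh : 0 ≤ h) (hρ : 1 ≤ ρ) (P₁ P₂ : Finset (EuclideanSpace ℝ (Fin 3))) (hP₁X : P₁ ⊆ X) (hP₂X : P₂ ⊆ X)
    (hcell : ∀ p ∈ X, -(2 * R₀) ≤ p 2 ∧ p 2 ≤ h + 2 * R₀ ∧ p 0 ^ 2 + p 1 ^ 2 ≤ ρ ^ 2)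
    (hP₁ : ∀ p, p ∈ P₁ ↔ (p ∈ stacking L₁ s₀ σ₁ ∧ -(2 * R₀) ≤ p 2 ∧ p 2 ≤ -R₀ ∧ p 0 ^ 2 + p 1 ^ 2 ≤ ρ ^ 2))
    (hP₂ : ∀ p, p ∈ P₂ ↔ (p ∈ stacking L₂ s₂ σ₂ ∧ h + R₀ ≤ p 2 ∧ p 2 ≤ h + 2 * R₀ ∧ p 0 ^ 2 + p 1 ^ 2 ≤ ρ ^ 2))
    {u : EuclideanSpace ℝ (Fin 3)} (hu : u ∈ fccSlots) (α β : ℤ) (huαβ : u = (α : ℝ) • triangularVec₁ 1 + (β : ℝ) • triangularVec₂ 1)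
    (hrise : (3 / 4 : ℝ) ≤ (L₁ u) 2)
    (hapart : L₁ '' fccStacking 1 (Real.sqrt (2 / 3)) ≠ L₂ '' fccStacking 1 (Real.sqrt (2 / 3)) ∧
      L₁ '' fccStacking 1 (Real.sqrt (2 / 3)) ≠
        (twinFrame L₂ (L₂ (EuclideanSpace.single (2 : Fin 3) (1 : ℝ)))) '' fccStacking 1 (Real.sqrt (2 / 3)))
    (k a b : ℤ) (hk' : σ₁ (k - 1) = 1) (hk : σ₁ k = -1)
    (hylo : -(2 * R₀) + 2 ≤ (L₁ (barlowPos 1 (Real.sqrt (2 / 3)) σ₁ k a b) + s₀) 2)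
    (hyhi : (L₁ (barlowPos 1 (Real.sqrt (2 / 3)) σ₁ k a b) + s₀) 2 ≤ -R₀ - 2)
    (hylat : Real.sqrt ((L₁ (barlowPos 1 (Real.sqrt (2 / 3)) σ₁ k a b) + s₀) 0 ^ 2 +
      (L₁ (barlowPos 1 (Real.sqrt (2 / 3)) σ₁ k a b) + s₀) 1 ^ 2) + 4 / 3 * (h + 4 * R₀) + 5 ≤ ρ)
    {N : ℕ} (hN : h + 4 * R₀ ≤ 3 / 4 * (N : ℝ)) :
    ∃ n : ℕ, n ≤ N ∧
      hRowRun X ((LinearIsometryEquiv.neg ℝ).trans L₁) (-u) N (L₁ (barlowPos 1 (Real.sqrt (2 / 3)) σ₁ k a b) + s₀) =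
        L₁ (barlowPos 1 (Real.sqrt (2 / 3)) σ₁ k a b) + s₀ + (n : ℝ) • L₁ u ∧
      hRowRun X ((LinearIsometryEquiv.neg ℝ).trans L₁) (-u) N (L₁ (barlowPos 1 (Real.sqrt (2 / 3)) σ₁ k a b) + s₀) ∈
        X.filter (fun y => (X.filter fun q => dist y q = 1).card ≠ 12 ∧ -R₀ - 2 ≤ y 2 ∧ y 2 ≤ h + R₀ + 2) ∧
      ∀ (F' : EuclideanSpace ℝ (Fin 3) ≃ₗᵢ[ℝ] EuclideanSpace ℝ (Fin 3)) (q : EuclideanSpace ℝ (Fin 3)), q ∈ fccSlots →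
        (3 : ℝ) / 8 ≤ (F' q) 2 →
          ¬ WalkCertified12 X
            (hRowRun X ((LinearIsometryEquiv.neg ℝ).trans L₁) (-u) N (L₁ (barlowPos 1 (Real.sqrt (2 / 3)) σ₁ k a b) + s₀)) ⟨F', q, 0⟩ := by
  classical
  set F : EuclideanSpace ℝ (Fin 3) ≃ₗᵢ[ℝ] EuclideanSpace ℝ (Fin 3) := (LinearIsometryEquiv.neg ℝ).trans L₁ with hFdef
  have hF : ∀ x : EuclideanSpace ℝ (Fin 3), F x = L₁ (-x) := fun x => rfl
  have hFu : F (-u) = L₁ u := by rw [hF, neg_neg]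
  have hu2 : u 2 = 0 := by
    rw [huαβ]
    obtain ⟨-, -, h12, -, -, h22⟩ := Summit.Ventures.Crystal3D.Cruxes.TextureLiminf.TexShadow.triangularVec_coords
    simp [h12, h22]
  have hnu : -u ∈ fccSlots := neg_mem_fccSlots hu
  have hnu2 : (-u) 2 = 0 := by rw [PiLp.neg_apply, hu2, neg_zero]
  have hLu1 : ‖L₁ u‖ = 1 := by rw [LinearIsometryEquiv.norm_map, norm_eq_one_of_mem_fccSlots hu]
  have hLu2 : (L₁ u) 2 ≤ 1 := by
    have h1 := abs_apply_sub_le_dist (L₁ u) 0 2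
    rw [dist_zero_right, hLu1] at h1
    have : (0 : EuclideanSpace ℝ (Fin 3)) 2 = 0 := rfl
    rw [this, sub_zero] at h1
    exact (abs_le.1 h1).2
  have hriseF : (3 / 4 : ℝ) ≤ (F (-u)) 2 := by rw [hFu]; exact hrise
  have hapartF : F '' fccStacking 1 (Real.sqrt (2 / 3)) ≠ L₂ '' fccStacking 1 (Real.sqrt (2 / 3)) ∧
      F '' fccStacking 1 (Real.sqrt (2 / 3)) ≠
        (twinFrame L₂ (L₂ (EuclideanSpace.single (2 : Fin 3) (1 : ℝ)))) '' fccStacking 1 (Real.sqrt (2 / 3)) := by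
    rw [hFdef, image_negTrans_fcc]; exact hapart
  -- the predecessor site and the start
  set p₀ := barlowPos 1 (Real.sqrt (2 / 3)) σ₁ k (a - α) (b - β) with hp₀
  have hp₀u : p₀ + u = barlowPos 1 (Real.sqrt (2 / 3)) σ₁ k a b := by
    rw [hp₀, huαβ, barlowPos_add_inplane, sub_add_cancel, sub_add_cancel]
  have hy₀ : L₁ (barlowPos 1 (Real.sqrt (2 / 3)) σ₁ k a b) + s₀ = L₁ p₀ + s₀ + L₁ u := by
    rw [← hp₀u, map_add]; abel
  have hp2 : (L₁ p₀ + s₀) 2 = (L₁ (barlowPos 1 (Real.sqrt (2 / 3)) σ₁ k a b) + s₀) 2 - (L₁ u) 2 := by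
    rw [hy₀]; simp
  have hplat : Real.sqrt ((L₁ p₀ + s₀) 0 ^ 2 + (L₁ p₀ + s₀) 1 ^ 2) ≤
      Real.sqrt ((L₁ (barlowPos 1 (Real.sqrt (2 / 3)) σ₁ k a b) + s₀) 0 ^ 2 +
        (L₁ (barlowPos 1 (Real.sqrt (2 / 3)) σ₁ k a b) + s₀) 1 ^ 2) + 1 := by
    have h1 := sqrt_lateral_add_le (L₁ (barlowPos 1 (Real.sqrt (2 / 3)) σ₁ k a b) + s₀) (-(L₁ u))
    have e : L₁ (barlowPos 1 (Real.sqrt (2 / 3)) σ₁ k a b) + s₀ + -L₁ u = L₁ p₀ + s₀ := by rw [hy₀]; abel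
    rw [e, norm_neg, hLu1] at h1
    exact h1
  have hcomp : ∀ q ∈ barlowStacking 1 (Real.sqrt (2 / 3)) σ₁, dist q p₀ ≤ 1 → L₁ q + s₀ ∈ X := by
    refine barlowWindow_complete L₁ s₀ R₀ ρ hρ P₁ hP₁X hP₁ k (a - α) (b - β) (by rw [hp2]; linarith) (by rw [hp2]; linarith) ?_
    have h0 : 0 ≤ (L₁ p₀ + s₀) 0 ^ 2 + (L₁ p₀ + s₀) 1 ^ 2 := by positivity
    have hrr : Real.sqrt ((L₁ p₀ + s₀) 0 ^ 2 + (L₁ p₀ + s₀) 1 ^ 2) ≤ ρ - 1 := by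
      have : 0 ≤ 4 / 3 * (h + 4 * R₀) := by positivity
      linarith
    have hρ1 : 0 ≤ ρ - 1 := by linarith
    have h7 := pow_le_pow_left₀ (Real.sqrt_nonneg _) hrr 2
    rwa [Real.sq_sqrt h0] at h7
  -- the invariant at the start (type B: the dozen is `p₀ − hcpSlots = p₀ + F·hcpSlots`)
  have hI : HRowInv X F (-u) (L₁ (barlowPos 1 (Real.sqrt (2 / 3)) σ₁ k a b) + s₀) := by
    have h := hRowInv_start_barlow_B σ₁ L₁ s₀ k (a - α) (b - β) hk' hk hcomp hnu hnu2
    rw [neg_neg] at h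
    rw [hy₀]; exact h
  obtain ⟨n, hn, hrun, -, -, hPAY, hfar⟩ := hRow_member_core σ₁ L₁ s₀ hX hσ₁ hModel hJ hσ₂ L₂ s₂ R₀ h ρ hR₀ hh P₁ P₂ hP₁X hP₂X
    hcell hP₁ hP₂ hnu hnu2 hriseF hapartF hI hylo hyhi (by linarith) hN
  refine ⟨n, hn, ?_, hPAY, hfar⟩
  rw [hrun, hFu]

end Cell

/-! ### Ends on distinct rows are distinct -/

/-- **Row rigidity of the ends.**  Two points `L (layerSite σ L z k i j) + s₀ + n·L w` and `L (layerSite σ L z k' i' j') + s₀ + n'·L w`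
(`w = bestLayerDir L z`) on the row lines `(k, j)`, `(k', j')` coincide only if `(k, j) = (k', j')`. -/
theorem layerRow_end_eq (σ : ℤ → ℤ) (L : EuclideanSpace ℝ (Fin 3) ≃ₗᵢ[ℝ] EuclideanSpace ℝ (Fin 3)) (s₀ z : EuclideanSpace ℝ (Fin 3))
    {a₀ b₀ a₁ b₁ : ℤ} (hdet : a₀ * b₁ - a₁ * b₀ = 1)
    (hw : bestLayerDir L z = (a₀ : ℝ) • triangularVec₁ 1 + (b₀ : ℝ) • triangularVec₂ 1)
    (hw' : bestLayerPartner L z = (a₁ : ℝ) • triangularVec₁ 1 + (b₁ : ℝ) • triangularVec₂ 1)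
    {k i j k' i' j' : ℤ} {n n' : ℕ}
    (h : L (layerSite σ L z k i j) + s₀ + (n : ℝ) • L (bestLayerDir L z) =
      L (layerSite σ L z k' i' j') + s₀ + (n' : ℝ) • L (bestLayerDir L z)) :
    k = k' ∧ j = j' := by
  have e1 : L (layerSite σ L z k i j) + s₀ + (n : ℝ) • L (bestLayerDir L z) = L (layerSite σ L z k (i + n) j) + s₀ := by
    rw [layerSite_add_nat, map_add, LinearIsometryEquiv.map_smul]; abel
  have e2 : L (layerSite σ L z k' i' j') + s₀ + (n' : ℝ) • L (bestLayerDir L z) = L (layerSite σ L z k' (i' + n') j') + s₀ := by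
    rw [layerSite_add_nat, map_add, LinearIsometryEquiv.map_smul]; abel
  rw [e1, e2] at h
  have h' : layerSite σ L z k (i + n) j = layerSite σ L z k' (i' + n') j' := L.injective (add_right_cancel h)
  obtain ⟨hk, -, hj⟩ := layerSite_injective σ L z hdet hw hw' h'
  exact ⟨hk, hj⟩

end Summit.Ventures.Crystal3D.Theorems

end
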